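import Summits.QuantumFields.YangMills.Theorems.ForcedResponseSkewnessResponseLocalisationContactOfFemtoToolkit
import Summits.QuantumFields.YangMills.Theorems.ForcedResponseSkewnessResponseLocalisationContactOfFemtoCumulant
import HarnessLib

/-!
# Route `ForcedResponseSkewness`, crux `ResponseLocalisation` (stmt-QuantumFields-24869), line «signed-femto-collar»: smeared cumulant identity

Helper file (`--supports stmt-QuantumFields-24869`, seat `ym-line-frs-p2` g6) for the registered analysis stub `stub_symContactOfFemto`
(`SymContactOfFemtoSigR := FBLPinnedSigR → SymNearCovLawSigR → SymContactKernelSigR`, Defs p613181): the SMEARED form of the lead's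
`Femto.torusK3_eq_integral_centred` — for a finite family of near sites `z + w` with weights `c w`,
`Σ_w c w · κ₃(z+w, y, z) = ⟨(dens y − ⟨dens y⟩)(W − ⟨W⟩)⟩`, `W = Σ_w c w (dens (z+w) − m w)(dens z − m_z)` (linearity of the integral;
bounded continuous integrands on the torus).  This is what lets the radial weight of `SymContactKernelSigR` sit INSIDE the near observable
of the two-observable collar bound.

Honest label: bookkeeping on a conditional rung line (leaf R2a `BalabanLadder.NT`); NT and the YM mass gap are NOT proved by this.
-/

set_option autoImplicit false

noncomputable section

namespace Summit.QuantumFields.YangMills.Cruxes.ResponseLocalisation.Signed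

open MeasureTheory Filter Topology
open Literature.MathematicalPhysics.QuantumFieldTheory Literature.MathematicalPhysics.QuantumLattice
open Literature.Probability.LatticeModels
open Summit.QuantumFields.YangMills.Cruxes.OSLegsFromFemtoAndGap.DlrCollarTransfer
open Summit.QuantumFields.YangMills.Cruxes.ResponseLocalisation.Femto

/-! ## §1 Smeared centred-moment identities -/

section Smear

variable {G : Type} [Group G] [TopologicalSpace G] [IsTopologicalGroup G] [CompactSpace G]
  [MeasurableSpace G] [BorelSpace G] [SecondCountableTopology G] (r : LatticeRep G)

/-- **Smeared third cumulant as a two-observable centred moment.**  For a finite family of sites `z + w`, `w ∈ B`, weights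
`c w` and the torus means `m w = ⟨dens (z+w)⟩`, `mz = ⟨dens z⟩`:
`Σ_{w ∈ B} c w · κ₃(z+w, y, z) = ⟨(dens y − ⟨dens y⟩)(W − ⟨W⟩)⟩` with `W = Σ_w c w (dens (z+w) − m w)(dens z − mz)`. [folklore] -/
theorem sum_torusK3_eq_integral_centred (β : ℝ) (L : ℕ) (y z : Fin 4 → ℤ) (B : Finset (Fin 4 → ℤ)) (c : (Fin 4 → ℤ) → ℝ)
    (m : (Fin 4 → ℤ) → ℝ) (mz : ℝ) (hm : ∀ w, m w = torusE G r β L (dens G r (z + w)))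
    (hmz : mz = torusE G r β L (dens G r z)) :
    ∑ w ∈ B, c w * torusK3 G r β L (z + w) y z =
      ∫ V, (dens G r y (torusLift (2 * L + 1) V) - ∫ V', dens G r y (torusLift (2 * L + 1) V') ∂(wilsonMeasure r.ρ β)) *
        ((fun U => ∑ w ∈ B, c w * ((dens G r (z + w) U - m w) * (dens G r z U - mz))) (torusLift (2 * L + 1) V) -
          ∫ V', (fun U => ∑ w ∈ B, c w * ((dens G r (z + w) U - m w) * (dens G r z U - mz))) (torusLift (2 * L + 1) V')
            ∂(wilsonMeasure r.ρ β)) ∂(wilsonMeasure r.ρ β) := by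
  classical
  haveI : NeZero (2 * L + 1) := ⟨by omega⟩
  haveI := isProbabilityMeasure_wilsonMeasure (d := 4) (L := 2 * L + 1) r.ρ r.continuous β
  obtain ⟨CA, hCA⟩ := r.curvature.bounded
  set μT := wilsonMeasure (d := 4) (L := 2 * L + 1) r.ρ β with hμT
  -- notation
  set Yc : GaugeConfig 4 (2 * L + 1) G → ℝ := fun V =>
    dens G r y (torusLift (2 * L + 1) V) - ∫ V', dens G r y (torusLift (2 * L + 1) V') ∂μT with hYc
  set Ww : (Fin 4 → ℤ) → LGConfig 4 G → ℝ := fun w U => (dens G r (z + w) U - m w) * (dens G r z U - mz) with hWw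
  -- boundedness / continuity / integrability of the pieces
  have hdc : ∀ x : Fin 4 → ℤ, Continuous fun V : GaugeConfig 4 (2 * L + 1) G => dens G r x (torusLift (2 * L + 1) V) :=
    fun x => (continuous_dens r x).comp (continuous_torusLift (2 * L + 1))
  have hWc : ∀ w, Continuous fun V : GaugeConfig 4 (2 * L + 1) G => Ww w (torusLift (2 * L + 1) V) := fun w => by
    simp only [hWw]
    exact ((hdc (z + w)).sub continuous_const).mul ((hdc z).sub continuous_const)
  have hWb : ∀ w V, |Ww w (torusLift (2 * L + 1) V)| ≤ (CA + |m w|) * (CA + |mz|) := fun w V => by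
    simp only [hWw]
    rw [abs_mul]
    have h1 : |dens G r (z + w) (torusLift (2 * L + 1) V) - m w| ≤ CA + |m w| :=
      (abs_sub _ _).trans (add_le_add (hCA _) le_rfl)
    have h2 : |dens G r z (torusLift (2 * L + 1) V) - mz| ≤ CA + |mz| :=
      (abs_sub _ _).trans (add_le_add (hCA _) le_rfl)
    exact mul_le_mul h1 h2 (abs_nonneg _) ((abs_nonneg _).trans h1)
  have hWi : ∀ w, Integrable (fun V => Ww w (torusLift (2 * L + 1) V)) μT := fun w =>
    integrable_of_abs_le (hWc w).measurable (hWb w)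
  have hYb : ∀ V, |Yc V| ≤ CA + |∫ V', dens G r y (torusLift (2 * L + 1) V') ∂μT| := fun V => by
    simp only [hYc]
    exact (abs_sub _ _).trans (add_le_add (hCA _) le_rfl)
  have hYcont : Continuous Yc := by simp only [hYc]; exact (hdc y).sub continuous_const
  -- each summand `Yc · c w · (Ww w ∘ lift − E)` is integrable
  have hTi : ∀ w, Integrable (fun V => Yc V * (c w * (Ww w (torusLift (2 * L + 1) V) -
      ∫ V', Ww w (torusLift (2 * L + 1) V') ∂μT))) μT := by
    intro w
    refine integrable_of_abs_le (hYcont.mul (continuous_const.mul ((hWc w).sub continuous_const))).measurable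
      (C := (CA + |∫ V', dens G r y (torusLift (2 * L + 1) V') ∂μT|) *
        (|c w| * ((CA + |m w|) * (CA + |mz|) + |∫ V', Ww w (torusLift (2 * L + 1) V') ∂μT|))) fun V => ?_
    rw [abs_mul, abs_mul]
    refine mul_le_mul (hYb V) (mul_le_mul_of_nonneg_left ((abs_sub _ _).trans (add_le_add (hWb w V) le_rfl))
      (abs_nonneg _)) (by positivity) ((abs_nonneg _).trans (hYb V))
  -- rewrite each cumulant and collect
  have hK : ∀ w ∈ B, c w * torusK3 G r β L (z + w) y z =
      ∫ V, Yc V * (c w * (Ww w (torusLift (2 * L + 1) V) - ∫ V', Ww w (torusLift (2 * L + 1) V') ∂μT)) ∂μT := by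
    intro w _
    rw [torusK3_eq_integral_centred r β L (z + w) y z (m w) mz (hm w) hmz, ← integral_const_mul]
    refine integral_congr_ae (ae_of_all _ fun V => ?_)
    simp only [hYc, hWw, hμT]
    ring
  rw [Finset.sum_congr rfl hK, ← integral_finsetSum _ fun w _ => hTi w]
  -- the mean of the smeared observable is the smeared sum of the means
  have hmean : (∫ V', (fun U => ∑ w ∈ B, c w * ((dens G r (z + w) U - m w) * (dens G r z U - mz)))
      (torusLift (2 * L + 1) V') ∂μT) = ∑ w ∈ B, c w * ∫ V', Ww w (torusLift (2 * L + 1) V') ∂μT := by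
    simp only [hWw]
    rw [integral_finsetSum _ fun w _ => (hWi w).const_mul (c w)]
    refine Finset.sum_congr rfl fun w _ => ?_
    exact integral_const_mul _ _
  rw [hmean]
  refine integral_congr_ae (ae_of_all _ fun V => ?_)
  simp only [hWw]
  rw [← Finset.sum_sub_distrib, Finset.mul_sum]
  refine Finset.sum_congr rfl fun w _ => ?_
  simp only [hYc]
  ring

end Smear

end Summit.QuantumFields.YangMills.Cruxes.ResponseLocalisation.Signed

end
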